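import Summits.AtomisticToContinuum.HydrodynamicLimit.Theorems.LambertianContactSwapLambertianEulerSecondMoment
import HarnessLib

/-!
# The mean of the Lambert cosine law (crux `LambertianEuler`, stmt-AtomisticToContinuum-11854, line `Sketch`, stub `stub_lambertDirMean`)

Registered stub `stub_lambertDirMean` of the lead skeleton v15 (`Cruxes/LambertianEuler/Lines/Sketch.lean`,
§2b, a tool of the kernel `stub_windowProductionBoundLambda`): for a contact normal `ω ≠ 0` of `ℝ³`,
`ω̂ = ω/‖ω‖`, and a standard Gaussian vector `ξ`, the Lambertian (cosine-law) direction
`n = lambertDir ω ξ = normalize(ω̂ + ξ̂)` has MEAN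

  `E[n] = ∫ lambertDir ω ξ dγ(ξ) = (2/3) ω̂`   (`stub_lambertDirMean`, Bochner integral in `ℝ³`).

So the flux-averaged Lambertian momentum transfer `(‖g‖/2)(E[n]·ω̂ + ⟨|ĝ·ω̂|⟩) = (‖g‖/2)(2/3 + 2/3)`
equals the specular one `(2/3)‖g‖`: the two gases share the hard-sphere equation of state at the level
of conditional means (the collisional entropy production of the line's window step).

## Proof

* AXIAL PART (`integral_inner_lambertDir_self`): `E⟪ω̂, n⟫ = 2/3`. The integrand is nonnegative
  (`inner_lambertDir_nonneg`), so the Bochner integral is a `lintegral`; by the Lambert law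
  (`…LambertLaw.lambertLaw`: `∫ F(n) dγ = ∫ 4 (⟪ω̂, ξ̂⟫)₊ F(ξ̂) dγ`) and Archimedes' hat-box theorem
  (`…Archimedes.archimedesV3`: `⟪ω̂, ξ⟫/‖ξ‖` is uniform on `[-1, 1]`) it equals
  `½ ∫_{-1}^{1} 4 t₊ t dt = ½ · 4/3 = 2/3` (`integral_weight_mul`).
* SYMMETRY (`integral_lambertDir_map`, `inner_integral_lambertDir_eq_zero`): the mean vector
  `m = E[n]` is fixed by every linear isometry `L` of `ℝ³` fixing `ω` (the Gaussian is `L`-invariant,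
  `stdGaussian_map`, and `lambertDir ω (L ξ) = L (lambertDir ω ξ)`, `map_lambertDir_V3`); for `c ⊥ ω`
  the reflection through `(ℝ ∙ c)ᗮ` fixes `ω` and negates `c`, whence `⟪c, m⟫ = -⟪c, m⟫ = 0`.
  Applied to `c = m - ⟪ω̂, m⟫ ω̂` this gives `m = ⟪ω̂, m⟫ ω̂ = (2/3) ω̂`.

References: J. H. Lambert, *Photometria* (1760) (cosine law); F. Celestini, F. Mortessagne, *Cosine law
at the atomic scale*, Phys. Rev. E 77 (2008); R. Feres, G. Yablonsky, Chem. Eng. Sci. 59 (2004) §2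
(Knudsen cosine law as the invariant reflection law); all statements here [folklore].
-/

noncomputable section

namespace Summit.AtomisticToContinuum.HydrodynamicLimit.Theorems.LambertianContactSwapLambertianEulerLambertDirMean

open scoped BigOperators Topology ENNReal InnerProductSpace
open MeasureTheory ProbabilityTheory Filter Set InformationTheory
open Literature.MathematicalPhysics.KineticTheory
open Literature.Analysis.FluidPDE Literature.Analysis.FluidPDE.Alexander
open Summit.AtomisticToContinuum.HydrodynamicLimit.Theorems.LambertianContactSwapLambertianEulerLambertLaw
open Summit.AtomisticToContinuum.HydrodynamicLimit.Theorems.LambertianContactSwapLambertianEulerArchimedes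
open Summit.AtomisticToContinuum.HydrodynamicLimit.Theorems.LambertianContactSwapLambertianEulerSecondMoment

/-! ### Integrability -/

/-- The Lambertian direction is Bochner integrable against the standard Gaussian (it is measurable and
bounded by `1`). [folklore] -/
theorem integrable_lambertDir (ω : V3) : Integrable (fun ξ : V3 => lambertDir ω ξ) (stdGaussian V3) :=
  Integrable.of_bound (measurable_const.lambertDir measurable_id).aestronglyMeasurable 1
    (Eventually.of_forall fun ξ => norm_lambertDir_le_one ω ξ)

/-- The components `⟪c, lambertDir ω ξ⟫` are integrable. [folklore] -/
theorem integrable_inner_lambertDir (ω c : V3) :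
    Integrable (fun ξ : V3 => ⟪c, lambertDir ω ξ⟫_ℝ) (stdGaussian V3) :=
  (integrable_lambertDir ω).const_inner c

/-! ### The axial first moment `E⟪ω̂, n⟫ = 2/3` -/

/-- `∫_{-1}^{1} 4 t₊ t dt = 4/3`. [folklore] -/
theorem integral_weight_mul : ∫ t in (-1 : ℝ)..1, 4 * max t 0 * t = 4 / 3 := by
  have hint : ∀ a b : ℝ, IntervalIntegrable (fun t : ℝ => 4 * max t 0 * t) volume a b :=
    fun a b => ((continuous_const.mul (continuous_id.max continuous_const)).mul
      continuous_id).intervalIntegrable a b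
  have h1 : ∫ t in (-1 : ℝ)..0, 4 * max t 0 * t = 0 := by
    rw [intervalIntegral.integral_congr (g := fun _ => (0 : ℝ)) fun t ht => ?_]
    · exact intervalIntegral.integral_zero
    · rw [uIcc_of_le (by norm_num)] at ht
      simp only [max_eq_right ht.2, mul_zero, zero_mul]
  have h2 : ∫ t in (0 : ℝ)..1, 4 * max t 0 * t = 4 / 3 := by
    rw [intervalIntegral.integral_congr (g := fun t : ℝ => 4 * t ^ 2) fun t ht => ?_]
    · rw [intervalIntegral.integral_const_mul, integral_pow]
      norm_num
    · rw [uIcc_of_le zero_le_one] at ht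
      simp only [max_eq_left ht.1]
      ring
  rw [← intervalIntegral.integral_add_adjacent_intervals (hint (-1) 0) (hint 0 1), h1, h2, zero_add]

/-- `½ ∫⁻_{[-1,1]} 4 t₊ · t dt = 2/3` in `ℝ≥0∞`. [folklore] -/
theorem lintegral_weight_mul :
    2⁻¹ * ∫⁻ t in Icc (-1 : ℝ) 1, ENNReal.ofReal (4 * max t 0) * ENNReal.ofReal t =
      ENNReal.ofReal (2 / 3) := by
  have hmul : ∀ t : ℝ, ENNReal.ofReal (4 * max t 0) * ENNReal.ofReal t =
      ENNReal.ofReal (4 * max t 0 * t) := by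
    intro t
    rcases le_or_gt 0 t with ht | ht
    · exact (ENNReal.ofReal_mul (by positivity)).symm
    · rw [ENNReal.ofReal_of_nonpos ht.le, mul_zero, max_eq_right ht.le]
      simp
  have hcont : Continuous fun t : ℝ => 4 * max t 0 * t :=
    (continuous_const.mul (continuous_id.max continuous_const)).mul continuous_id
  have hnn : ∀ t ∈ Icc (-1 : ℝ) 1, 0 ≤ 4 * max t 0 * t := by
    intro t _
    rcases le_or_gt 0 t with ht | ht
    · positivity
    · rw [max_eq_right ht.le]; simp
  simp_rw [hmul]
  rw [← ofReal_integral_eq_lintegral_ofReal hcont.integrableOn_Icc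
      (ae_restrict_of_forall_mem measurableSet_Icc hnn), integral_Icc_eq_integral_Ioc,
    ← intervalIntegral.integral_of_le (by norm_num : (-1 : ℝ) ≤ 1), integral_weight_mul,
    show (2 : ℝ≥0∞)⁻¹ = ENNReal.ofReal 2⁻¹ by
      rw [ENNReal.ofReal_inv_of_pos two_pos, ENNReal.ofReal_ofNat],
    ← ENNReal.ofReal_mul (by norm_num)]
  norm_num

/-- **The axial first moment of the cosine law**: for a unit normal `ω`,
`E⟪ω, lambertDir ω ξ⟫ = 2/3` (Lambert law + Archimedes: `½ ∫_0^1 4 t² dt`). [folklore] -/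
theorem integral_inner_lambertDir_self {ω : V3} (hω : ‖ω‖ = 1) :
    ∫ ξ, ⟪ω, lambertDir ω ξ⟫_ℝ ∂(stdGaussian V3) = 2 / 3 := by
  have hω0 : ω ≠ 0 := fun h => by
    rw [h, norm_zero] at hω
    exact zero_ne_one hω
  have hω1 : ‖ω‖⁻¹ • ω = ω := by rw [hω, inv_one, one_smul]
  have hF : Measurable fun n : V3 => ENNReal.ofReal ⟪ω, n⟫_ℝ := by fun_prop
  have hm : Measurable fun ξ : V3 => ⟪ω, lambertDir ω ξ⟫_ℝ :=
    measurable_const.inner (measurable_const.lambertDir measurable_id)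
  have hG : Measurable fun t : ℝ => ENNReal.ofReal (4 * max t 0) * ENNReal.ofReal t :=
    (ENNReal.measurable_ofReal.comp (measurable_const.mul (measurable_id.max measurable_const))).mul
      ENNReal.measurable_ofReal
  have hhat : ∀ ξ : V3, ⟪ω, ‖ξ‖⁻¹ • ξ⟫_ℝ = ⟪ω, ξ⟫_ℝ / ‖ξ‖ := fun ξ => by
    rw [real_inner_smul_right, div_eq_inv_mul]
  have key := lambertLaw ω hω0 _ hF
  rw [hω1] at key
  rw [integral_eq_lintegral_of_nonneg_ae (Eventually.of_forall fun ξ => inner_lambertDir_nonneg ω ξ)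
    hm.aestronglyMeasurable, key]
  simp_rw [hhat]
  rw [archimedesV3 ω hω _ hG, lintegral_weight_mul, ENNReal.toReal_ofReal (by norm_num)]

/-! ### Rotational symmetry of the mean about the contact normal -/

/-- **Invariance of the mean under isometries fixing the normal**: if `L` is a linear isometry of
`ℝ³` with `L ω = ω` then `L (E[lambertDir ω ξ]) = E[lambertDir ω ξ]`. [folklore] -/
theorem integral_lambertDir_map {ω : V3} (L : V3 ≃ₗᵢ[ℝ] V3) (hL : L ω = ω) :
    L (∫ ξ, lambertDir ω ξ ∂(stdGaussian V3)) = ∫ ξ, lambertDir ω ξ ∂(stdGaussian V3) := by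
  have hmap : (stdGaussian V3).map L = stdGaussian V3 := stdGaussian_map L
  -- `L` commutes with the Bochner integral
  have h1 : L (∫ ξ, lambertDir ω ξ ∂(stdGaussian V3)) =
      ∫ ξ, L (lambertDir ω ξ) ∂(stdGaussian V3) :=
    (L.toContinuousLinearEquiv.toContinuousLinearMap.integral_comp_comm (integrable_lambertDir ω)).symm
  -- change of variables by the Gaussian-preserving `L`
  have h2 := integral_map_equiv (μ := stdGaussian V3) L.toHomeomorph.toMeasurableEquiv
    (fun ξ : V3 => lambertDir ω ξ)
  have hcoe : ⇑L.toHomeomorph.toMeasurableEquiv = L := rfl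
  rw [hcoe, hmap] at h2
  rw [h1, h2]
  refine integral_congr_ae (Eventually.of_forall fun ξ => ?_)
  show L (lambertDir ω ξ) = lambertDir ω (L ξ)
  rw [map_lambertDir_V3, hL]

/-- **Components orthogonal to the normal vanish**: for `c ⊥ ω`, `⟪c, E[lambertDir ω ξ]⟫ = 0` — the
reflection through `(ℝ ∙ c)ᗮ` fixes `ω` and negates `c`. [folklore] -/
theorem inner_integral_lambertDir_eq_zero {ω c : V3} (hc : ⟪c, ω⟫_ℝ = 0) :
    ⟪c, ∫ ξ, lambertDir ω ξ ∂(stdGaussian V3)⟫_ℝ = 0 := by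
  set R : V3 ≃ₗᵢ[ℝ] V3 := (ℝ ∙ c)ᗮ.reflection with hR
  have hRω : R ω = ω := Submodule.reflection_mem_subspace_eq_self
    (Submodule.mem_orthogonal_singleton_iff_inner_right.2 hc)
  have hRc : R c = -c := Submodule.reflection_orthogonalComplement_singleton_eq_neg _
  have hfix := integral_lambertDir_map R hRω
  have h : ⟪c, ∫ ξ, lambertDir ω ξ ∂(stdGaussian V3)⟫_ℝ =
      -⟪c, ∫ ξ, lambertDir ω ξ ∂(stdGaussian V3)⟫_ℝ := by
    conv_lhs => rw [← LinearIsometryEquiv.inner_map_map R c, hRc, hfix, inner_neg_left]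
  linarith

/-- The mean for a UNIT normal: `E[lambertDir ω ξ] = (2/3) ω`. [folklore] -/
theorem integral_lambertDir_unit {ω : V3} (hω : ‖ω‖ = 1) :
    ∫ ξ, lambertDir ω ξ ∂(stdGaussian V3) = (2 / 3 : ℝ) • ω := by
  set m : V3 := ∫ ξ, lambertDir ω ξ ∂(stdGaussian V3) with hm
  -- axial component
  have hax : ⟪ω, m⟫_ℝ = 2 / 3 := by
    rw [hm, ← integral_inner (integrable_lambertDir ω) ω]
    exact integral_inner_lambertDir_self hω
  -- the orthogonal part `m - ⟪ω, m⟫ ω` is orthogonal to `ω`, hence kills `m`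
  have hωω : ⟪ω, ω⟫_ℝ = 1 := by rw [real_inner_self_eq_norm_sq, hω, one_pow]
  have hperp : ⟪m - ⟪ω, m⟫_ℝ • ω, ω⟫_ℝ = 0 := by
    rw [inner_sub_left, real_inner_smul_left, hωω, mul_one, real_inner_comm, sub_self]
  have hzero := inner_integral_lambertDir_eq_zero (ω := ω) hperp
  rw [← hm] at hzero
  -- `‖m - ⟪ω, m⟫ ω‖² = ⟪m - ⟪ω, m⟫ ω, m⟫ - ⟪ω, m⟫ ⟪m - ⟪ω, m⟫ ω, ω⟫ = 0`
  have hnorm : ‖m - ⟪ω, m⟫_ℝ • ω‖ ^ 2 = 0 := by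
    rw [← real_inner_self_eq_norm_sq, inner_sub_right, real_inner_smul_right, hzero, hperp]
    ring
  have heq : m - ⟪ω, m⟫_ℝ • ω = 0 := by
    rwa [sq_eq_zero_iff, norm_eq_zero] at hnorm
  rw [sub_eq_zero] at heq
  rw [heq, hax]

/-! ### The registered stub -/

/-- **Registered stub `stub_lambertDirMean`** (line `Sketch`, crux stmt-AtomisticToContinuum-11854, skeleton
v15 §2b): **the mean of the Lambert cosine law** — for a contact normal `ω ≠ 0` and a standard Gaussian `ξ` of
`ℝ³`, `E[lambertDir ω ξ] = (2/3) ω/‖ω‖`: the mean cosine `∫_{-1}^{1} 4 t₊ · t dt/2 = 2/3` of Lambert's law along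
`ω̂` and rotational symmetry about `ω̂`. [folklore] -/
theorem stub_lambertDirMean :
    ∀ ω : V3, ω ≠ 0 → ∫ ξ, lambertDir ω ξ ∂(stdGaussian V3) = (2 / 3 : ℝ) • (‖ω‖⁻¹ • ω) := by
  intro ω hω
  have hn : ‖ω‖ ≠ 0 := norm_ne_zero_iff.2 hω
  have hunit : ‖‖ω‖⁻¹ • ω‖ = 1 := by rw [norm_smul, norm_inv, norm_norm, inv_mul_cancel₀ hn]
  have hdir : ∀ ξ, lambertDir ω ξ = lambertDir (‖ω‖⁻¹ • ω) ξ := fun ξ =>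
    (lambertDir_smul_left (inv_pos.2 (norm_pos_iff.2 hω)) ω ξ).symm
  simp_rw [hdir]
  exact integral_lambertDir_unit hunit

end Summit.AtomisticToContinuum.HydrodynamicLimit.Theorems.LambertianContactSwapLambertianEulerLambertDirMean

end
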